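import Summits.NavierStokesRegularity.TurbBounds.SpectralFormFreeSlip
import Summits.NavierStokesRegularity.TurbBounds.FSU1.Mode.M01Calculus
import Summits.NavierStokesRegularity.TurbBounds.FSU1.Mode.M03Defs

/-!
# FS-U1″ mode lemma — StiffnessOdd (`TurbBounds/FSU1/Mode/M12StiffnessOdd.lean`)

FS-PROOF-DRAFT §3.6, odd class: `V′(0)² ≤ M·W_half` — `SO.stiffnessOdd : StiffnessOdd` (explicit half-line domination).

Cell-made mathematics of FS-PROOF-DRAFT §3 (pub-turb-sos), kernel-checked; generated from the design compose file
`StageF_compose.check.lean` (96c4b9bf…) by `build_mode_split.py`.  HONEST FRAMING: rigorous bounds for the stated PDE and boundary conditions; no claim about physical turbulence beyond the bound.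
-/

open Real intervalIntegral MeasureTheory Set

namespace Summit.NavierStokesRegularity.TurbBounds.FSU1.Mode

open Summit.NavierStokesRegularity.TurbBounds.SpectralFormFreeSlip

namespace SO

/-! ### 1. Elementary calculus -/

/-! ### 2. Regularity of `V ∈ C³` and of `Ω = vort k V` (verbatim idiom of Stage C) -/

/-! ### 3. Hyperbolic sign facts -/

/-- `y ↦ y coth y` is monotone on `(0, ∞)`. -/
theorem ycoth_mono : MonotoneOn (fun y : ℝ => y * Real.cosh y / Real.sinh y) (Ioi 0) := by
  refine monotoneOn_of_hasDerivWithinAt_nonneg (convex_Ioi 0)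
    (f' := fun y => (Real.sinh y * Real.cosh y - y) / Real.sinh y ^ 2) ?_ ?_ ?_
  · refine ContinuousOn.div (by fun_prop) Real.continuous_sinh.continuousOn (fun y hy => ?_)
    exact (Real.sinh_pos_iff.2 hy).ne'
  · intro y hy
    rw [interior_Ioi] at hy
    have hs : Real.sinh y ≠ 0 := (Real.sinh_pos_iff.2 hy).ne'
    have h1 : HasDerivAt (fun y => y * Real.cosh y) (1 * Real.cosh y + y * Real.sinh y) y :=
      (hasDerivAt_id y).mul (Real.hasDerivAt_cosh y)
    have h2 := h1.div (Real.hasDerivAt_sinh y) hs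
    have en : ((1 * Real.cosh y + y * Real.sinh y) * Real.sinh y - y * Real.cosh y * Real.cosh y)
        = Real.sinh y * Real.cosh y - y := by
      linear_combination (-y) * Real.cosh_sq y
    rw [en] at h2
    exact h2.hasDerivWithinAt
  · intro y hy
    rw [interior_Ioi] at hy
    have hs : 0 < Real.sinh y := Real.sinh_pos_iff.2 hy
    have h1 : y ≤ Real.sinh y := Real.self_le_sinh_iff.2 hy.le
    have h2 : 1 ≤ Real.cosh y := Real.one_le_cosh y
    apply div_nonneg _ (sq_nonneg _)
    nlinarith

/-- For `0 < k ≤ μ`, `x ↦ log sinh(μx) − log sinh(kx)` is monotone on `(0, ∞)`. -/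
theorem logratio_mono {k μ : ℝ} (hk : 0 < k) (hkμ : k ≤ μ) :
    MonotoneOn (fun x : ℝ => Real.log (Real.sinh (μ * x)) - Real.log (Real.sinh (k * x))) (Ioi 0) := by
  have hμ : 0 < μ := lt_of_lt_of_le hk hkμ
  refine monotoneOn_of_hasDerivWithinAt_nonneg (convex_Ioi 0)
    (f' := fun x => μ * Real.cosh (μ * x) / Real.sinh (μ * x) - k * Real.cosh (k * x) / Real.sinh (k * x)) ?_ ?_ ?_
  · intro x hx
    have h1 : Real.sinh (μ * x) ≠ 0 := (Real.sinh_pos_iff.2 (mul_pos hμ hx)).ne'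
    have h2 : Real.sinh (k * x) ≠ 0 := (Real.sinh_pos_iff.2 (mul_pos hk hx)).ne'
    exact (((hasDerivAt_sinh_mul μ x).log h1).sub ((hasDerivAt_sinh_mul k x).log h2)).continuousAt.continuousWithinAt
  · intro x hx
    rw [interior_Ioi] at hx
    have h1 : Real.sinh (μ * x) ≠ 0 := (Real.sinh_pos_iff.2 (mul_pos hμ hx)).ne'
    have h2 : Real.sinh (k * x) ≠ 0 := (Real.sinh_pos_iff.2 (mul_pos hk hx)).ne'
    exact (((hasDerivAt_sinh_mul μ x).log h1).sub ((hasDerivAt_sinh_mul k x).log h2)).hasDerivWithinAt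
  · intro x hx
    rw [interior_Ioi] at hx
    have hkx : 0 < k * x := mul_pos hk hx
    have hμx : 0 < μ * x := mul_pos hμ hx
    have hm := ycoth_mono (show k * x ∈ Ioi (0:ℝ) from hkx) (show μ * x ∈ Ioi (0:ℝ) from hμx)
      (mul_le_mul_of_nonneg_right hkμ hx.le)
    simp only at hm
    have hs1 : 0 < Real.sinh (k * x) := Real.sinh_pos_iff.2 hkx
    have hs2 : 0 < Real.sinh (μ * x) := Real.sinh_pos_iff.2 hμx
    rw [div_le_div_iff₀ hs1 hs2] at hm
    rw [sub_nonneg, div_le_div_iff₀ hs1 hs2]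
    nlinarith [hm, hx]

/-- The sign fact behind `φ_D ≥ 0`: `sinh(μu)·sinh(kL) ≤ sinh(ku)·sinh(μL)` for `0 < k ≤ μ`, `0 ≤ u ≤ L`. -/
theorem sinh_prod_le {k μ u L : ℝ} (hk : 0 < k) (hkμ : k ≤ μ) (hu : 0 ≤ u) (huL : u ≤ L) :
    Real.sinh (μ * u) * Real.sinh (k * L) ≤ Real.sinh (k * u) * Real.sinh (μ * L) := by
  have hμ : 0 < μ := lt_of_lt_of_le hk hkμ
  rcases hu.eq_or_lt with h0 | hupos
  · rw [← h0]; simp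
  have hL : 0 < L := lt_of_lt_of_le hupos huL
  have a1 : 0 < Real.sinh (μ * u) := Real.sinh_pos_iff.2 (mul_pos hμ hupos)
  have a2 : 0 < Real.sinh (k * L) := Real.sinh_pos_iff.2 (mul_pos hk hL)
  have a3 : 0 < Real.sinh (k * u) := Real.sinh_pos_iff.2 (mul_pos hk hupos)
  have a4 : 0 < Real.sinh (μ * L) := Real.sinh_pos_iff.2 (mul_pos hμ hL)
  have hm := logratio_mono hk hkμ (show u ∈ Ioi (0:ℝ) from hupos) (show L ∈ Ioi (0:ℝ) from hL) huL
  simp only at hm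
  have : Real.log (Real.sinh (μ * u) * Real.sinh (k * L)) ≤ Real.log (Real.sinh (k * u) * Real.sinh (μ * L)) := by
    rw [Real.log_mul a1.ne' a2.ne', Real.log_mul a3.ne' a4.ne']
    linarith
  exact (Real.log_le_log_iff (mul_pos a1 a2) (mul_pos a3 a4)).1 this

/-- `ψ_k(s) ≤ e^{−ks}` on `s ≥ 0`: in fact `e^{−ks} sinh(kL) − sinh(k(L−s)) = e^{−kL} sinh(ks) ≥ 0`. -/
theorem sinh_lin_le_exp {k L s : ℝ} (hk : 0 < k) (hL : 0 < L) (hs : 0 ≤ s) :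
    Real.sinh (k * (L - s)) / Real.sinh (k * L) ≤ Real.exp (-k * s) := by
  have hsL : 0 < Real.sinh (k * L) := Real.sinh_pos_iff.2 (mul_pos hk hL)
  rw [div_le_iff₀ hsL]
  have iden : Real.exp (-k * s) * Real.sinh (k * L) - Real.sinh (k * (L - s))
      = Real.exp (-(k * L)) * Real.sinh (k * s) := by
    rw [Real.sinh_eq, Real.sinh_eq, Real.sinh_eq]
    have e1 : Real.exp (k * (L - s)) = Real.exp (k * L) * Real.exp (-k * s) := by
      rw [← Real.exp_add]; ring_nf
    have e2 : Real.exp (-(k * (L - s))) = Real.exp (-(k * L)) * Real.exp (k * s) := by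
      rw [← Real.exp_add]; ring_nf
    have e3 : Real.exp (-k * s) * Real.exp (k * s) = 1 := by
      rw [← Real.exp_add]; simp
    have e4 : Real.exp (-(k * L)) * Real.exp (k * L) = 1 := by
      rw [← Real.exp_add]; simp
    have e5 : Real.exp (-(k * s)) = Real.exp (-k * s) := by ring_nf
    rw [e1, e2, e5]
    nlinarith [e3, e4]
  have hpos : 0 ≤ Real.exp (-(k * L)) * Real.sinh (k * s) :=
    mul_nonneg (Real.exp_pos _).le (Real.sinh_nonneg_iff.2 (by positivity))
  linarith


/-! ### 4. The explicit test functions -/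

/-- `ψ_m(x) = sinh m(L−x) / sinh mL`. -/
noncomputable def psi (m L x : ℝ) : ℝ := Real.sinh (m * (L - x)) / Real.sinh (m * L)
/-- `ψ_m'`. -/
noncomputable def dpsi (m L x : ℝ) : ℝ := -m * Real.cosh (m * (L - x)) / Real.sinh (m * L)

/-- Derivative of `ψ_c(x) = sinh(c(L−x))/sinh(cL)`. -/
theorem hasDerivAt_psi (m L x : ℝ) : HasDerivAt (psi m L) (dpsi m L x) x := by
  unfold psi dpsi
  exact (hasDerivAt_sinh_lin m L x).div_const (Real.sinh (m * L))

/-- Second derivative of `ψ_c`. -/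
theorem hasDerivAt_dpsi (m L x : ℝ) : HasDerivAt (dpsi m L) (m ^ 2 * psi m L x) x := by
  unfold psi dpsi
  have h := ((hasDerivAt_cosh_lin m L x).const_mul (-m)).div_const (Real.sinh (m * L))
  have e : -m * (-m * Real.sinh (m * (L - x))) / Real.sinh (m * L)
      = m ^ 2 * (Real.sinh (m * (L - x)) / Real.sinh (m * L)) := by ring
  rw [e] at h
  exact h

/-- The Dirichlet solution `φ_D = A (ψ_k − ψ_μ)` of `−αφ'' + νφ = kψ_k` on `[0, L]` (`A = k/β₀`). -/
noncomputable def phiD (A k μ L x : ℝ) : ℝ := A * (psi k L x - psi μ L x)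
/-- `φ_D'`. -/
noncomputable def dphiD (A k μ L x : ℝ) : ℝ := A * (dpsi k L x - dpsi μ L x)
/-- `φ_D''`. -/
noncomputable def ddphiD (A k μ L x : ℝ) : ℝ := A * (k ^ 2 * psi k L x - μ ^ 2 * psi μ L x)

/-- Derivative of the Dirichlet test function `φ_D`. -/
theorem hasDerivAt_phiD (A k μ L x : ℝ) : HasDerivAt (phiD A k μ L) (dphiD A k μ L x) x := by
  unfold phiD dphiD
  exact ((hasDerivAt_psi k L x).sub (hasDerivAt_psi μ L x)).const_mul A

/-- Second derivative of `φ_D`. -/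
theorem hasDerivAt_dphiD (A k μ L x : ℝ) : HasDerivAt (dphiD A k μ L) (ddphiD A k μ L x) x := by
  unfold dphiD ddphiD
  exact ((hasDerivAt_dpsi k L x).sub (hasDerivAt_dpsi μ L x)).const_mul A

/-- The half-line solution `φ_∞ = A (e^{−kx} − e^{−μx})` of `−αφ'' + νφ = k e^{−kx}`, `φ(0) = 0`. -/
noncomputable def phiI (A k μ x : ℝ) : ℝ := A * (Real.exp (-k * x) - Real.exp (-μ * x))
/-- `φ_∞'`. -/
noncomputable def dphiI (A k μ x : ℝ) : ℝ := A * (-k * Real.exp (-k * x) - -μ * Real.exp (-μ * x))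
/-- `φ_∞''`. -/
noncomputable def ddphiI (A k μ x : ℝ) : ℝ :=
  A * (-k * (-k * Real.exp (-k * x)) - -μ * (-μ * Real.exp (-μ * x)))

/-- Derivative of the half-line comparison function `φ_∞`. -/
theorem hasDerivAt_phiI (A k μ x : ℝ) : HasDerivAt (phiI A k μ) (dphiI A k μ x) x := by
  unfold phiI dphiI
  exact ((hasDerivAt_exp_lin k x).sub (hasDerivAt_exp_lin μ x)).const_mul A

/-- Second derivative of `φ_∞`. -/
theorem hasDerivAt_dphiI (A k μ x : ℝ) : HasDerivAt (dphiI A k μ) (ddphiI A k μ x) x := by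
  unfold dphiI ddphiI
  exact (((hasDerivAt_exp_lin k x).const_mul (-k)).sub ((hasDerivAt_exp_lin μ x).const_mul (-μ))).const_mul A

/-- `−αφ_D'' + νφ_D = kψ_k` (uses `αμ² = αk² + β₀`, `Aβ₀ = k`). -/
theorem opD {α β₀ k μ A : ℝ} (hA : A * β₀ = k) (hαμ : α * μ ^ 2 = α * k ^ 2 + β₀) (L x : ℝ) :
    -α * ddphiD A k μ L x + (α * k ^ 2 + β₀) * phiD A k μ L x = k * psi k L x := by
  unfold ddphiD phiD
  linear_combination (psi k L x) * hA + (A * psi μ L x) * hαμ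

/-- `−αφ_∞'' + νφ_∞ = k e^{−kx}`. -/
theorem opI {α β₀ k μ A : ℝ} (hA : A * β₀ = k) (hαμ : α * μ ^ 2 = α * k ^ 2 + β₀) (x : ℝ) :
    -α * ddphiI A k μ x + (α * k ^ 2 + β₀) * phiI A k μ x = k * Real.exp (-k * x) := by
  unfold ddphiI phiI
  linear_combination (Real.exp (-k * x)) * hA + (A * Real.exp (-μ * x)) * hαμ

/-- `∫₀ᴸ k e^{−kx} φ_∞(x) dx` in closed form. -/
theorem int_kexp_phiI (A k μ L : ℝ) (hk : k ≠ 0) (hkμ : k + μ ≠ 0) :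
    ∫ x in (0:ℝ)..L, k * Real.exp (-k * x) * phiI A k μ x
      = k * A * ((1 - Real.exp (-k * L) ^ 2) / (2 * k) - (1 - Real.exp (-k * L) * Real.exp (-μ * L)) / (k + μ)) := by
  have hP : ∀ x, HasDerivAt (fun x => k * A * (-(Real.exp (-k * x) * Real.exp (-k * x)) / (2 * k)
      + Real.exp (-k * x) * Real.exp (-μ * x) / (k + μ))) (k * Real.exp (-k * x) * phiI A k μ x) x := by
    intro x
    have h1 := hasDerivAt_exp_lin k x
    have h2 := hasDerivAt_exp_lin μ x
    have h3 := ((((h1.mul h1).neg).div_const (2 * k)).add ((h1.mul h2).div_const (k + μ))).const_mul (k * A)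
    refine h3.congr_deriv ?_
    unfold phiI
    field_simp
    ring
  have cI : Continuous fun x => k * Real.exp (-k * x) * phiI A k μ x := by unfold phiI; fun_prop
  rw [intervalIntegral.integral_eq_sub_of_hasDerivAt (fun x _ => hP x) (cI.intervalIntegrable _ _)]
  simp only [mul_zero, Real.exp_zero, mul_one]
  field_simp
  ring

/-- The algebra behind `a_L(φ_∞) ≤ M`: the deficit is `k/(α(μ²−k²)²)·(kμ(y−x)² + x²(μ−k)²/2) ≥ 0`. -/
theorem alg_key {α k μ x y : ℝ} (hα : 0 < α) (hk : 0 < k) (hkμ : k < μ) :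
    k * (k / (α * (μ ^ 2 - k ^ 2))) * ((1 - x ^ 2) / (2 * k) - (1 - x * y) / (k + μ))
      + α * ((k / (α * (μ ^ 2 - k ^ 2))) * (-k * x - -μ * y) * ((k / (α * (μ ^ 2 - k ^ 2))) * (x - y)))
      ≤ k / (2 * α * (k + μ) ^ 2) := by
  have hμ : 0 < μ := lt_trans hk hkμ
  have h1 : μ ^ 2 - k ^ 2 ≠ 0 := by nlinarith
  have h2 : k + μ ≠ 0 := by linarith
  have key : k / (2 * α * (k + μ) ^ 2)
      - (k * (k / (α * (μ ^ 2 - k ^ 2))) * ((1 - x ^ 2) / (2 * k) - (1 - x * y) / (k + μ))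
        + α * ((k / (α * (μ ^ 2 - k ^ 2))) * (-k * x - -μ * y) * ((k / (α * (μ ^ 2 - k ^ 2))) * (x - y))))
      = k / (α * (μ ^ 2 - k ^ 2) ^ 2) * (k * μ * (y - x) ^ 2 + x ^ 2 * (μ - k) ^ 2 / 2) := by
    field_simp
    ring
  have hnn : 0 ≤ k / (α * (μ ^ 2 - k ^ 2) ^ 2) * (k * μ * (y - x) ^ 2 + x ^ 2 * (μ - k) ^ 2 / 2) := by
    positivity
  linarith

/-! ### 5. The theorem -/

/-- Stage D, odd class: the half-cell stiffness bound `V'(0)² ≤ M·W_half`. -/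
theorem stiffnessOdd : StiffnessOdd := by
  intro α β₀ k V hα hβ hk hV hV0 hV2 hVL hV2L
  -- constants
  have hL : (0:ℝ) < 1 / 2 := by norm_num
  set L : ℝ := 1 / 2 with hLdef
  set μ := muR α β₀ k with hμdef
  have hμsq : μ ^ 2 = k ^ 2 + β₀ / α := by
    rw [hμdef]; unfold muR; exact Real.sq_sqrt (by positivity)
  have hμpos : 0 < μ := by
    rw [hμdef]; unfold muR; exact Real.sqrt_pos.2 (by positivity)
  have hq : 0 < β₀ / α := div_pos hβ hα
  have hkμ : k < μ := by nlinarith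
  have hαμ : α * μ ^ 2 = α * k ^ 2 + β₀ := by
    rw [hμsq]; field_simp
  have hβ' : β₀ = α * (μ ^ 2 - k ^ 2) := by linarith [hαμ]
  set A := k / β₀ with hAdef
  have hA : A * β₀ = k := by rw [hAdef]; field_simp
  have hApos : 0 < A := div_pos hk hβ
  have hν : (0:ℝ) ≤ α * k ^ 2 + β₀ := by positivity
  -- regularity of V and Ω
  obtain ⟨hd0, hd1, hd2⟩ := diff_pack hV
  have hVd : ∀ x, HasDerivAt V (deriv V x) x := fun x => (hd0 x).hasDerivAt
  have hVdd : ∀ x, HasDerivAt (deriv V) (deriv (deriv V) x) x := fun x => (hd1 x).hasDerivAt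
  set Ω := vort k V with hΩdef
  have hΩd : ∀ x, HasDerivAt Ω (deriv Ω x) x := fun x => ((differentiable_vort hV k) x).hasDerivAt
  have cΩ' : Continuous (deriv Ω) := continuous_deriv_vort hV k
  have cΩ : Continuous Ω := (differentiable_vort hV k).continuous
  have hΩ0 : Ω 0 = 0 := by
    rw [hΩdef]; unfold vort; rw [hV2, hV0]; simp
  have hΩL : Ω L = 0 := by
    rw [hΩdef]; unfold vort; rw [hV2L, hVL]; simp
  have hkΩ : ∀ x, k * Ω x = deriv (deriv V) x - k ^ 2 * V x := by
    intro x; rw [hΩdef]; unfold vort; field_simp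
  have hsk : Real.sinh (k * L) ≠ 0 := (Real.sinh_pos_iff.2 (mul_pos hk hL)).ne'
  have hsμ : Real.sinh (μ * L) ≠ 0 := (Real.sinh_pos_iff.2 (mul_pos hμpos hL)).ne'
  -- (1) representation of V'(0)
  have rep : deriv V 0 = -∫ x in (0:ℝ)..L, psi k L x * (k * Ω x) := by
    have cψ'' : Continuous fun x => k ^ 2 * psi k L x := by unfold psi; fun_prop
    have G := green (a := (0:ℝ)) (b := L) k (fun x => hasDerivAt_psi k L x) (fun x => hasDerivAt_dpsi k L x)
      hVd hVdd cψ'' hd2.continuous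
    have z : (∫ x in (0:ℝ)..L, V x * (k ^ 2 * psi k L x - k ^ 2 * psi k L x)) = 0 := by simp
    have p0 : psi k L 0 = 1 := by unfold psi; rw [sub_zero]; exact div_self hsk
    have pL : psi k L L = 0 := by unfold psi; simp
    rw [z, hVL, hV0, p0, pL] at G
    have e : (∫ x in (0:ℝ)..L, psi k L x * (k * Ω x))
        = ∫ x in (0:ℝ)..L, psi k L x * (deriv (deriv V) x - k ^ 2 * V x) := by
      congr 1; funext x; rw [hkΩ]
    rw [e, G]; ring
  -- (2) ∫ kψ_k Ω = a(φ_D, Ω)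
  have cddD : Continuous (ddphiD A k μ L) := by unfold ddphiD psi; fun_prop
  have cdD : Continuous (dphiD A k μ L) := by unfold dphiD dpsi; fun_prop
  have cD : Continuous (phiD A k μ L) := by unfold phiD psi; fun_prop
  have I1 := ibp α (α * k ^ 2 + β₀) L (fun x => hasDerivAt_phiD A k μ L x) (fun x => hasDerivAt_dphiD A k μ L x)
    hΩd cddD cΩ'
  rw [hΩL, hΩ0, mul_zero, mul_zero, sub_zero, mul_zero, sub_zero] at I1
  have e1 : (∫ x in (0:ℝ)..L, psi k L x * (k * Ω x))
      = ∫ x in (0:ℝ)..L, (-α * ddphiD A k μ L x + (α * k ^ 2 + β₀) * phiD A k μ L x) * Ω x := by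
    congr 1; funext x; rw [opD hA hαμ]; ring
  have CS := wcs (L := L) hα.le hν hL.le cdD cD cΩ' cΩ
  -- (3) a(φ_D) ≤ M
  have φD0 : phiD A k μ L 0 = 0 := by
    unfold phiD psi; rw [sub_zero, div_self hsk, div_self hsμ]; ring
  have φDL : phiD A k μ L L = 0 := by unfold phiD psi; simp
  have φDnn : ∀ x ∈ Icc (0:ℝ) L, 0 ≤ phiD A k μ L x := by
    intro x hx
    unfold phiD
    apply mul_nonneg hApos.le
    rw [sub_nonneg]
    unfold psi
    rw [div_le_div_iff₀ (Real.sinh_pos_iff.2 (mul_pos hμpos hL)) (Real.sinh_pos_iff.2 (mul_pos hk hL))]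
    exact sinh_prod_le (u := L - x) (L := L) hk hkμ.le (by linarith [hx.2]) (by linarith [hx.1])
  have aD_le : (∫ x in (0:ℝ)..L, (α * dphiD A k μ L x ^ 2 + (α * k ^ 2 + β₀) * phiD A k μ L x ^ 2))
      ≤ Mhalf α β₀ k := by
    set X := ∫ x in (0:ℝ)..L, (α * dphiD A k μ L x ^ 2 + (α * k ^ 2 + β₀) * phiD A k μ L x ^ 2) with hXdef
    have hX0 : 0 ≤ X := intervalIntegral.integral_nonneg hL.le (fun x _ => by positivity)
    -- X = ∫ kψ_k φ_D
    have I2 := ibp α (α * k ^ 2 + β₀) L (fun x => hasDerivAt_phiD A k μ L x) (fun x => hasDerivAt_dphiD A k μ L x)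
      (fun x => hasDerivAt_phiD A k μ L x) cddD cdD
    rw [φDL, φD0, mul_zero, mul_zero, sub_zero, mul_zero, sub_zero] at I2
    have eX : X = ∫ x in (0:ℝ)..L, k * psi k L x * phiD A k μ L x := by
      rw [hXdef]
      have e2 : (∫ x in (0:ℝ)..L, (α * dphiD A k μ L x ^ 2 + (α * k ^ 2 + β₀) * phiD A k μ L x ^ 2))
          = ∫ x in (0:ℝ)..L, (α * (dphiD A k μ L x * dphiD A k μ L x)
              + (α * k ^ 2 + β₀) * (phiD A k μ L x * phiD A k μ L x)) := by
        congr 1; funext x; ring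
      rw [e2, ← I2]
      congr 1; funext x; rw [opD hA hαμ]
    -- X ≤ B = ∫ k e^{-kx} φ_D
    have cB : Continuous fun x => k * Real.exp (-k * x) * phiD A k μ L x := by unfold phiD psi; fun_prop
    have cX : Continuous fun x => k * psi k L x * phiD A k μ L x := by unfold phiD psi; fun_prop
    have hXB : X ≤ ∫ x in (0:ℝ)..L, k * Real.exp (-k * x) * phiD A k μ L x := by
      rw [eX]
      refine intervalIntegral.integral_mono_on hL.le (cX.intervalIntegrable _ _) (cB.intervalIntegrable _ _)
        (fun x hx => ?_)
      have h1 : psi k L x ≤ Real.exp (-k * x) := by unfold psi; exact sinh_lin_le_exp hk hL hx.1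
      exact mul_le_mul_of_nonneg_right (mul_le_mul_of_nonneg_left h1 hk.le) (φDnn x hx)
    -- B = a(φ_∞, φ_D) and Cauchy–Schwarz
    have cddI : Continuous (ddphiI A k μ) := by unfold ddphiI; fun_prop
    have cdI : Continuous (dphiI A k μ) := by unfold dphiI; fun_prop
    have cI : Continuous (phiI A k μ) := by unfold phiI; fun_prop
    have I3 := ibp α (α * k ^ 2 + β₀) L (fun x => hasDerivAt_phiI A k μ x) (fun x => hasDerivAt_dphiI A k μ x)
      (fun x => hasDerivAt_phiD A k μ L x) cddI cdD
    rw [φDL, φD0, mul_zero, mul_zero, sub_zero, mul_zero, sub_zero] at I3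
    have eB : (∫ x in (0:ℝ)..L, k * Real.exp (-k * x) * phiD A k μ L x)
        = ∫ x in (0:ℝ)..L, (α * (dphiI A k μ x * dphiD A k μ L x)
            + (α * k ^ 2 + β₀) * (phiI A k μ x * phiD A k μ L x)) := by
      rw [← I3]; congr 1; funext x; rw [opI hA hαμ]
    have CS2 := wcs (L := L) hα.le hν hL.le cdI cI cdD cD
    -- a(φ_∞) ≤ M
    have aI_le : (∫ x in (0:ℝ)..L, (α * dphiI A k μ x ^ 2 + (α * k ^ 2 + β₀) * phiI A k μ x ^ 2))
        ≤ Mhalf α β₀ k := by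
      have I4 := ibp α (α * k ^ 2 + β₀) L (fun x => hasDerivAt_phiI A k μ x) (fun x => hasDerivAt_dphiI A k μ x)
        (fun x => hasDerivAt_phiI A k μ x) cddI cdI
      have φI0 : phiI A k μ 0 = 0 := by unfold phiI; simp
      rw [φI0, mul_zero, sub_zero] at I4
      have e4 : (∫ x in (0:ℝ)..L, (-α * ddphiI A k μ x + (α * k ^ 2 + β₀) * phiI A k μ x) * phiI A k μ x)
          = ∫ x in (0:ℝ)..L, k * Real.exp (-k * x) * phiI A k μ x := by
        congr 1; funext x; rw [opI hA hαμ]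
      rw [e4, int_kexp_phiI A k μ L hk.ne' (by positivity)] at I4
      have e5 : (∫ x in (0:ℝ)..L, (α * dphiI A k μ x ^ 2 + (α * k ^ 2 + β₀) * phiI A k μ x ^ 2))
          = ∫ x in (0:ℝ)..L, (α * (dphiI A k μ x * dphiI A k μ x)
              + (α * k ^ 2 + β₀) * (phiI A k μ x * phiI A k μ x)) := by
        congr 1; funext x; ring
      rw [e5]
      have e6 : (∫ x in (0:ℝ)..L, (α * (dphiI A k μ x * dphiI A k μ x)
              + (α * k ^ 2 + β₀) * (phiI A k μ x * phiI A k μ x)))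
          = k * A * ((1 - Real.exp (-k * L) ^ 2) / (2 * k) - (1 - Real.exp (-k * L) * Real.exp (-μ * L)) / (k + μ))
            + α * (dphiI A k μ L * phiI A k μ L) := by
        linarith [I4]
      rw [e6]
      unfold dphiI phiI Mhalf
      rw [← hμdef, hAdef, hβ']
      have := alg_key (x := Real.exp (-k * L)) (y := Real.exp (-μ * L)) hα hk hkμ
      linarith [this]
    -- conclude X ≤ M
    have hB2 : (∫ x in (0:ℝ)..L, k * Real.exp (-k * x) * phiD A k μ L x) ^ 2 ≤ Mhalf α β₀ k * X := by
      rw [eB]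
      exact CS2.trans (mul_le_mul_of_nonneg_right aI_le hX0)
    have hXX : X * X ≤ Mhalf α β₀ k * X := by nlinarith [hXB, hB2, hX0]
    rcases hX0.eq_or_lt with hX00 | hXpos
    · rw [← hX00]
      unfold Mhalf; rw [← hμdef]; positivity
    · exact le_of_mul_le_mul_right hXX hXpos
  -- (4) assemble
  have hW : Wh α β₀ k V = ∫ x in (0:ℝ)..L, (α * deriv Ω x ^ 2 + (α * k ^ 2 + β₀) * Ω x ^ 2) := by
    rw [hΩdef]; unfold Wh; rw [← hLdef]
  have hWnn : 0 ≤ ∫ x in (0:ℝ)..L, (α * deriv Ω x ^ 2 + (α * k ^ 2 + β₀) * Ω x ^ 2) :=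
    intervalIntegral.integral_nonneg hL.le (fun x _ => by positivity)
  rw [hW]
  calc deriv V 0 ^ 2 = (∫ x in (0:ℝ)..L, psi k L x * (k * Ω x)) ^ 2 := by rw [rep]; ring
    _ = (∫ x in (0:ℝ)..L, (α * (dphiD A k μ L x * deriv Ω x) + (α * k ^ 2 + β₀) * (phiD A k μ L x * Ω x))) ^ 2 := by
        rw [e1, I1]
    _ ≤ (∫ x in (0:ℝ)..L, (α * dphiD A k μ L x ^ 2 + (α * k ^ 2 + β₀) * phiD A k μ L x ^ 2))
          * (∫ x in (0:ℝ)..L, (α * deriv Ω x ^ 2 + (α * k ^ 2 + β₀) * Ω x ^ 2)) := CS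
    _ ≤ Mhalf α β₀ k * (∫ x in (0:ℝ)..L, (α * deriv Ω x ^ 2 + (α * k ^ 2 + β₀) * Ω x ^ 2)) :=
        mul_le_mul_of_nonneg_right aD_le hWnn

end SO

end Summit.NavierStokesRegularity.TurbBounds.FSU1.Mode
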